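import Summits.BirchSwinnertonDyer.Rank1Residual.WAll.ConjunctionYanZhu
import Literature.NumberTheory.EllipticCurves.GrossZagierRankOneProofs
import HarnessLib

/-!
# Rung W-ALL of ladder BSD (D-0120) — the leading-term reading with ONE sign binder: the rank-one
# Gross–Zagier binder `hGZ : gross_zagier_rank_one_rat` DERIVED, and the kernel with every
# Gross–Zagier-side input a single printed theorem (cell `bsd-wall`, lane (2), seat `bsd-wall-ty-1`)

HONEST FRAMING (cell `bsd-wall`, run/shared/lean/pub/bsd-wall/; brief `WALL-BRIEF-v1.md` sha16
b966bf16da27706e; `Rank1Residual/WAll/Target.lean`): W-ALL is OPEN; the files of this directory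
PROVE only bookkeeping. THIS FILE TOO: theorems only — no definition, no `@[conjecture]`, no named
fact is introduced, nothing is asserted about any curve, nothing is booked, no route file is
imported; every published theorem enters as one of the tree's existing named Literature facts BY
NAME and stays a hypothesis. What changes is WHICH facts the leading-term reading of rung W-ALL
rests on.

## What this file proves

`ConjunctionDischarged.lean` / `ConjunctionYanZhu.lean` give the leading-term form `WAllFormula`
of rung W-ALL (the full BSD formula, `W.BSDTriple`, for every `E/ℚ` of analytic rank `≤ 1`) from
the closed list of exclusion classes, TWELVE (resp. ELEVEN) named published facts and TWO SIGN
BINDERS: `hL0 : re_entireLFunction_one_nonneg` (`L(E,1) ≥ 0`; Guo 1996 / Lapid–Rallis 2003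
Thm. 1) and `hGZ : gross_zagier_rank_one_rat` (rank-one Gross–Zagier over `ℚ` with a POSITIVE
real constant: `L'(E,1) = c · ĥ(P)`, `c > 0`, `P ∈ E(ℚ)`), consumed for the sign of `#Ш_an` at
`r_an = 1` (`shaAn_re_pos_of_analyticRank_le_one'`).

The second sign binder is now a THEOREM of the tree relative to facts already in the kernel's own
input cone: `Literature/NumberTheory/EllipticCurves/GrossZagierRankOneProofs.lean`
(`gross_zagier_rank_one_rat_of_nonempty_modularParametrizationData`) derives
`gross_zagier_rank_one_rat` from
* `hmodP : nonempty_modularParametrizationData` (BCDT 2001 Thm. A with (6) — ALREADY a binder),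
* `hL0 : re_entireLFunction_one_nonneg` (ALREADY the other sign binder),
* `hWa : waldspurger_exists_heegnerField_twist_ne_zero` (Waldspurger 1985, Thm. 5),
* `hGZ : gross_zagier` (Gross–Zagier 1986 Thm. V.(2.1) over `K`, in the form of Cai–Shu–Tian 2014
  Thm. 1.1),
along Gross–Zagier 1986 V.§2 (pp. 312–313) with Darmon's Prop. 3.11, Hecke's functional equation
with its sign, Atkin–Lehner's theorem, the parity of the analytic rank and Silverman VIII.9.3 all
PROVED in the tree. `hWa` and `hGZ` are two of the five named inputs of the tree's road of record
for the rank binder `hGZK : rank_eq_analyticRank_of_analyticRank_le_one` (Darmon 2004 Thm. 3.22,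
`rank_eq_analyticRank_of_analyticRank_le_one_of_nonempty_modularParametrizationData`: from
`hmodP`, `hWa`, `hMM` Murty–Murty 1991, `hGZ`, `hKo` Kolyvagin 1990 Thm. A). Hence:

1. `wAllFormula_of_wAll_oneSign` — **`WAll ⇒ WAllFormula` with ONE sign binder**: hypotheses
   `hmodP`, `hL0`, `hWa`, `hGZ` (over `K`); `gross_zagier_rank_one_rat` no longer appears.
2. `wAllFormula_of_exclusions_oneSign` — the leading-term reading from the closed list, the TWELVE
   named facts of `ConjunctionDischarged`, ONE sign binder, and `hWa`, `hGZ`.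
3. `wAll_of_exclusions_primaryGZ` / `wAll_iff_exclusions_primaryGZ` — the kernel with the composite
   rank binder `hGZK` ALSO fed from its road of record: W-ALL ⟺ the closed list modulo FIFTEEN
   named facts `hSk hBCS hJSW hCGS hGV hGr hmodP hWa hMM hGZ hKo hCM hKob hYZ hLLT`, those on
   the Gross–Zagier side each the tree's statement of ONE printed theorem (modularity (6),
   Waldspurger, Murty–Murty, Gross–Zagier V.(2.1), Kolyvagin Thm. A);
   `wAllFormula_of_exclusions_primaryGZ` — its leading-term reading with the single sign binder
   `hL0` (sixteen named hypotheses, none of them `rank_eq_analyticRank_of_analyticRank_le_one` or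
   `gross_zagier_rank_one_rat`).
4. `wAllFormula_of_exclusions_yanZhuImForm_primaryGZ` — the same on top of `ConjunctionYanZhu`
   (BCS25 Cor. 1.3.1 dropped through Yan–Zhu's printed (Im) form): FOURTEEN named facts + `hL0`.

COUNTS, EXACTLY (numbers, not adjectives): form (2) has 12 + 1 + 2 = 15 named hypotheses against
`wAllFormula_of_exclusions_discharged`'s 12 + 2 = 14 — one MORE name, but the dropped name
(`gross_zagier_rank_one_rat`, classed VERBATIM-COMPOSITE by the ARM-P reading `bsd-cited` r05 S5,
sheet 07d3aca5564146d5) is replaced by two single-theorem facts that the rank binder's road of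
record consumes anyway; form (3) has 15 + 1 = 16 names with BOTH composite Gross–Zagier-side names
(`hGZK`, `hGZ`) gone; form (4) has 14 + 1 = 15. No census number moves; typed ≠ proved ≠ endorsed;
BSD is not proved by any of this.

References: `Rank1Residual/WAll/Target.lean`, `…/Conjunction.lean`, `…/ConjunctionDischarged.lean`,
`…/ConjunctionYanZhu.lean`; `Literature/…/GrossZagierRankOneProofs.lean`,
`Literature/…/HeegnerPointsModularityProofs.lean` (the road of record for `hGZK`);
[cite: GrossZagier1986, Thm. V.(2.1) (p. 311) and V.§2 (pp. 312–313)]; [cite: Darmon2004, Thm. 3.22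
and §3.9]; [cite: BCDTJAMS2001, Theorem A]; [cite: Miller2011LMS, §1 and Def. 1.1].
-/

noncomputable section

open scoped Classical

open WeierstrassCurve Literature.NumberTheory.EllipticCurves
  Literature.NumberTheory.EllipticCurves.Rank1Residual
  Literature.NumberTheory.EllipticCurves.ModularForms
open Summit.BirchSwinnertonDyer.Rank1Residual

set_option autoImplicit false

namespace Summit.BirchSwinnertonDyer

/-! ### §1. The leading-term reading with ONE sign binder -/

/-- **`WAll` ⇒ the leading-term form, ONE sign binder.** Modularity in parametrisation form
(`hmodP`), the non-negativity of central values (`hL0`, the remaining sign binder), Waldspurger's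
non-vanishing twist (`hWa`) and the Gross–Zagier formula over the Heegner field (`hGZ`): the
rank-one Gross–Zagier binder `gross_zagier_rank_one_rat` of `wAllFormula_of_wAll_discharged` is
supplied by the tree theorem `gross_zagier_rank_one_rat_of_nonempty_modularParametrizationData`.
[cite: GrossZagier1986, Thm. V.(2.1) (p. 311) and V.§2 (pp. 312–313)] -/
theorem wAllFormula_of_wAll_oneSign (hmodP : nonempty_modularParametrizationData)
    (hL0 : re_entireLFunction_one_nonneg) (hWa : waldspurger_exists_heegnerField_twist_ne_zero)
    (hGZ : ∀ (N : ℕ) [NeZero N] (W : WeierstrassCurve ℚ) (K : Type) [Field K] [NumberField K],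
      gross_zagier N W K)
    (h : WAll) : WAllFormula :=
  wAllFormula_of_wAll_discharged hmodP hL0
    (gross_zagier_rank_one_rat_of_nonempty_modularParametrizationData hmodP hWa hGZ hL0) h

/-- **The leading-term form of rung W-ALL from the closed list, TWELVE named facts and ONE sign
binder** (plus Waldspurger and Gross–Zagier over `K`, which feed the derived rank-one Gross–Zagier
statement over `ℚ`). [cite: GrossZagier1986, Thm. V.(2.1) (p. 311) and V.§2 (pp. 312–313)] -/
theorem wAllFormula_of_exclusions_oneSign (h : WAllExclusions)
    (hSk : Skinner2016.thmC_padicValRat_bsd_rank_zero)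
    (hBCS : BurungaleCastellaSkinner2025.cor131_padicValRat_bsd_rank_le_one)
    (hJSW : JetchevSkinnerWan2017.thm121_padicValRat_bsd_rank_one)
    (hCGS : CastellaGrossiSkinner2025.thmD_padicValRat_bsd_rank_le_one)
    (hGV : GreenbergVatsal2000.thm13_charIdeal_eq_of_gvPar) (hGr : greenberg_charValue_rankZero)
    (hmodP : nonempty_modularParametrizationData)
    (hGZK : rank_eq_analyticRank_of_analyticRank_le_one)
    (hCM : bsdTriple_of_hasCM_of_L_one_ne_zero) (hKob : Kobayashi2013.cor14_bsdp_of_cm_rank_one)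
    (hYZ : YanZhu2026.thm415_padicValRat_bsd_rank_le_one)
    (hLLT : LiLiuTian2024.thm11_bsdp_of_cm_rank_one)
    (hL0 : re_entireLFunction_one_nonneg) (hWa : waldspurger_exists_heegnerField_twist_ne_zero)
    (hGZ : ∀ (N : ℕ) [NeZero N] (W : WeierstrassCurve ℚ) (K : Type) [Field K] [NumberField K],
      gross_zagier N W K) : WAllFormula :=
  wAllFormula_of_wAll_oneSign hmodP hL0 hWa hGZ
    (wAll_of_exclusions_discharged h hSk hBCS hJSW hCGS hGV hGr hmodP hGZK hCM hKob hYZ hLLT)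

/-! ### §2. The kernel with every Gross–Zagier-side input a single printed theorem -/

/-- **W-ALL from the packaged conjunction, FIFTEEN named facts, the Gross–Zagier side primary.**
As `wAll_of_exclusions_discharged`, with the rank binder
`hGZK : rank_eq_analyticRank_of_analyticRank_le_one` (Darmon 2004 Thm. 3.22) fed from its road of
record `rank_eq_analyticRank_of_analyticRank_le_one_of_nonempty_modularParametrizationData`
(`HeegnerPointsModularityProofs`): modularity (6) (`hmodP`, already a binder), Waldspurger 1985
(`hWa`), Murty–Murty 1991 (`hMM`), Gross–Zagier 1986 Thm. V.(2.1) (`hGZ`) and Kolyvagin 1990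
Thm. A (`hKo`), with Prop. 3.11, Hecke, Atkin–Lehner and the descent proved in the tree.
[cite: Darmon2004, Thm. 3.22 and §3.9] -/
theorem wAll_of_exclusions_primaryGZ (h : WAllExclusions)
    (hSk : Skinner2016.thmC_padicValRat_bsd_rank_zero)
    (hBCS : BurungaleCastellaSkinner2025.cor131_padicValRat_bsd_rank_le_one)
    (hJSW : JetchevSkinnerWan2017.thm121_padicValRat_bsd_rank_one)
    (hCGS : CastellaGrossiSkinner2025.thmD_padicValRat_bsd_rank_le_one)
    (hGV : GreenbergVatsal2000.thm13_charIdeal_eq_of_gvPar) (hGr : greenberg_charValue_rankZero)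
    (hmodP : nonempty_modularParametrizationData)
    (hWa : waldspurger_exists_heegnerField_twist_ne_zero)
    (hMM : murtyMurty_exists_heegnerField_twist_simpleZero)
    (hGZ : ∀ (N : ℕ) [NeZero N] (W : WeierstrassCurve ℚ) (K : Type) [Field K] [NumberField K],
      gross_zagier N W K)
    (hKo : ∀ (N : ℕ) [NeZero N] (W : WeierstrassCurve ℚ) (K : Type) [Field K] [NumberField K],
      kolyvagin N W K)
    (hCM : bsdTriple_of_hasCM_of_L_one_ne_zero) (hKob : Kobayashi2013.cor14_bsdp_of_cm_rank_one)
    (hYZ : YanZhu2026.thm415_padicValRat_bsd_rank_le_one)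
    (hLLT : LiLiuTian2024.thm11_bsdp_of_cm_rank_one) : WAll :=
  wAll_of_exclusions_discharged h hSk hBCS hJSW hCGS hGV hGr hmodP
    (rank_eq_analyticRank_of_analyticRank_le_one_of_nonempty_modularParametrizationData hmodP hWa hMM
      hGZ hKo)
    hCM hKob hYZ hLLT

/-- **The closed list is exactly W-ALL modulo FIFTEEN named facts, the Gross–Zagier side
primary.** [cite: Darmon2004, Thm. 3.22 and §3.9] -/
theorem wAll_iff_exclusions_primaryGZ (hSk : Skinner2016.thmC_padicValRat_bsd_rank_zero)
    (hBCS : BurungaleCastellaSkinner2025.cor131_padicValRat_bsd_rank_le_one)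
    (hJSW : JetchevSkinnerWan2017.thm121_padicValRat_bsd_rank_one)
    (hCGS : CastellaGrossiSkinner2025.thmD_padicValRat_bsd_rank_le_one)
    (hGV : GreenbergVatsal2000.thm13_charIdeal_eq_of_gvPar) (hGr : greenberg_charValue_rankZero)
    (hmodP : nonempty_modularParametrizationData)
    (hWa : waldspurger_exists_heegnerField_twist_ne_zero)
    (hMM : murtyMurty_exists_heegnerField_twist_simpleZero)
    (hGZ : ∀ (N : ℕ) [NeZero N] (W : WeierstrassCurve ℚ) (K : Type) [Field K] [NumberField K],
      gross_zagier N W K)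
    (hKo : ∀ (N : ℕ) [NeZero N] (W : WeierstrassCurve ℚ) (K : Type) [Field K] [NumberField K],
      kolyvagin N W K)
    (hCM : bsdTriple_of_hasCM_of_L_one_ne_zero) (hKob : Kobayashi2013.cor14_bsdp_of_cm_rank_one)
    (hYZ : YanZhu2026.thm415_padicValRat_bsd_rank_le_one)
    (hLLT : LiLiuTian2024.thm11_bsdp_of_cm_rank_one) : WAll ↔ WAllExclusions :=
  ⟨wAllExclusions_of_wAll, fun h ↦ wAll_of_exclusions_primaryGZ h hSk hBCS hJSW hCGS hGV hGr hmodP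
    hWa hMM hGZ hKo hCM hKob hYZ hLLT⟩

/-- **The leading-term form of rung W-ALL from the closed list, FIFTEEN named facts and ONE sign
binder** — neither `rank_eq_analyticRank_of_analyticRank_le_one` nor `gross_zagier_rank_one_rat`
among the hypotheses: both are fed from `hmodP`, `hWa`, `hMM`, `hGZ`, `hKo`, `hL0` by theorems of
the tree. [cite: GrossZagier1986, Thm. V.(2.1) (p. 311) and V.§2 (pp. 312–313)]
[cite: Darmon2004, Thm. 3.22 and §3.9] -/
theorem wAllFormula_of_exclusions_primaryGZ (h : WAllExclusions)
    (hSk : Skinner2016.thmC_padicValRat_bsd_rank_zero)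
    (hBCS : BurungaleCastellaSkinner2025.cor131_padicValRat_bsd_rank_le_one)
    (hJSW : JetchevSkinnerWan2017.thm121_padicValRat_bsd_rank_one)
    (hCGS : CastellaGrossiSkinner2025.thmD_padicValRat_bsd_rank_le_one)
    (hGV : GreenbergVatsal2000.thm13_charIdeal_eq_of_gvPar) (hGr : greenberg_charValue_rankZero)
    (hmodP : nonempty_modularParametrizationData)
    (hWa : waldspurger_exists_heegnerField_twist_ne_zero)
    (hMM : murtyMurty_exists_heegnerField_twist_simpleZero)
    (hGZ : ∀ (N : ℕ) [NeZero N] (W : WeierstrassCurve ℚ) (K : Type) [Field K] [NumberField K],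
      gross_zagier N W K)
    (hKo : ∀ (N : ℕ) [NeZero N] (W : WeierstrassCurve ℚ) (K : Type) [Field K] [NumberField K],
      kolyvagin N W K)
    (hCM : bsdTriple_of_hasCM_of_L_one_ne_zero) (hKob : Kobayashi2013.cor14_bsdp_of_cm_rank_one)
    (hYZ : YanZhu2026.thm415_padicValRat_bsd_rank_le_one)
    (hLLT : LiLiuTian2024.thm11_bsdp_of_cm_rank_one)
    (hL0 : re_entireLFunction_one_nonneg) : WAllFormula :=
  wAllFormula_of_wAll_oneSign hmodP hL0 hWa hGZ
    (wAll_of_exclusions_primaryGZ h hSk hBCS hJSW hCGS hGV hGr hmodP hWa hMM hGZ hKo hCM hKob hYZ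
      hLLT)

/-! ### §3. The same on top of the ELEVEN-fact form of `ConjunctionYanZhu` -/

/-- **The leading-term form of rung W-ALL from the closed list, FOURTEEN named facts and ONE sign
binder**: `ConjunctionYanZhu`'s eleven-fact kernel (BCS25 Cor. 1.3.1 dropped through Yan–Zhu's
printed (Im) form `hYZ`) with the rank binder and the rank-one Gross–Zagier binder fed from
`hmodP`, `hWa`, `hMM`, `hGZ`, `hKo`, `hL0` as in §2. Named hypotheses — the tree's existing
Literature facts with their print cites (PUB\* flags and the ARM-P readings travelling with them as
everywhere; on the Gross–Zagier side each is now ONE printed theorem): `hSk` Skinner 2016 Thm C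
· `hJSW` JSW17 Thm 1.2.1 · `hCGS` CGS25 Thm D · `hGV` Greenberg–Vatsal 2000 Thm 1.3 · `hGr`
Greenberg 1999 · `hmodP` BCDT 2001 Thm A (6) · `hWa` Waldspurger 1985 Thm 5 · `hMM` Murty–Murty
1991 · `hGZ` Gross–Zagier 1986 V.(2.1) / Cai–Shu–Tian 2014 Thm 1.1 · `hKo` Kolyvagin 1990 Thm A ·
`hCM` Rubin 1991 / Burungale–Flach 2024 · `hKob` Kobayashi 2013 Cor 1.4 · `hYZ` Yan–Zhu 2026
Thm 5.11 (Im) · `hLLT` Li–Liu–Tian 2024 Thm 1.1 · `hL0` Guo 1996 / Lapid–Rallis 2003 Thm 1.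
[cite: GrossZagier1986, Thm. V.(2.1) (p. 311) and V.§2 (pp. 312–313)]
[cite: Darmon2004, Thm. 3.22 and §3.9] -/
theorem wAllFormula_of_exclusions_yanZhuImForm_primaryGZ (h : WAllExclusions)
    (hSk : Skinner2016.thmC_padicValRat_bsd_rank_zero)
    (hJSW : JetchevSkinnerWan2017.thm121_padicValRat_bsd_rank_one)
    (hCGS : CastellaGrossiSkinner2025.thmD_padicValRat_bsd_rank_le_one)
    (hGV : GreenbergVatsal2000.thm13_charIdeal_eq_of_gvPar) (hGr : greenberg_charValue_rankZero)
    (hmodP : nonempty_modularParametrizationData)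
    (hWa : waldspurger_exists_heegnerField_twist_ne_zero)
    (hMM : murtyMurty_exists_heegnerField_twist_simpleZero)
    (hGZ : ∀ (N : ℕ) [NeZero N] (W : WeierstrassCurve ℚ) (K : Type) [Field K] [NumberField K],
      gross_zagier N W K)
    (hKo : ∀ (N : ℕ) [NeZero N] (W : WeierstrassCurve ℚ) (K : Type) [Field K] [NumberField K],
      kolyvagin N W K)
    (hCM : bsdTriple_of_hasCM_of_L_one_ne_zero) (hKob : Kobayashi2013.cor14_bsdp_of_cm_rank_one)
    (hYZ : YanZhu2026.thm415_padicValRat_bsd_rank_le_one_of_bigIm)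
    (hLLT : LiLiuTian2024.thm11_bsdp_of_cm_rank_one)
    (hL0 : re_entireLFunction_one_nonneg) : WAllFormula :=
  wAllFormula_of_wAll_oneSign hmodP hL0 hWa hGZ
    (wAll_of_exclusions_yanZhuImForm h hSk hJSW hCGS hGV hGr hmodP
      (rank_eq_analyticRank_of_analyticRank_le_one_of_nonempty_modularParametrizationData hmodP hWa
        hMM hGZ hKo)
      hCM hKob hYZ hLLT)

end Summit.BirchSwinnertonDyer

end
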